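import Summits.QuantumFields.YangMills.Theorems.UnitScaleTiltProp7CentrePinnedHessianPoincareCovFrames
import HarnessLib

/-!
# Route `UnitScaleTilt`, crux K1 «MinimiserStabilityRegPr» (stmt-QuantumFields-19200), route-R E′ path (α′), S2 = P-cov2 ∕ (E1-b) covariant, brick (D1-cov) at the member — ROOT FORM:
# the `hP` row of the covariant Agmon core at `C := range (embIter (K−n))`, `U := unitsField (toUField W)`, `i := 0`, `N := 2`

Cell `ym3-torus`, width seat `ym3-torus-px4` (gen 3); sequel (v1.1, separate file for the 400-line budget) of ✓ `Prop7CentrePinnedHessianPoincareCovFrames` (p671512, row «(D1-cov)-FRAMES»,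
★routeR-w3 g6 GO 2026-08-28T21:47:43Z).  THEOREMS ONLY (0 `def`, 0 `sorry`); `--supports stmt-QuantumFields-19200`, count-neutral.  YM₃ on T³ is a ladder rung (R3), not the Clay
problem; nothing here claims a stub, the crux, d = 4 or the mass gap.

WHAT IS PROVED (ns `…Theorems.Prop7CentrePinnedHessianPoincareCovFramesRoot`).  ★★ `sqrt_sum_hs_le_of_regPr` — for odd `L = ℓ + 1 ≥ 5` there are `c35, a₅ > 0` (those of ✓
`sum_hs_le_covLaplace_hs_of_regPr`) such that for every member `(m, n, K, a′, R)`, every `α₀ > 0` with `M·α₀ ≤ a₅`, every `W ∈ RegPr`, every plaquette bound `a` in `plaqU` letters and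
the ℓ_k-free window `κ₁ℓ_k⁴·d²(4Na² + (2τ₂ + 4τ₁²)²) ≤ 1∕4` (`τ₁ = ηC′e^{ηC′}`, `τ₂ = η(ηC′)e^{ηC′}`, `η = ℓ_k⁻¹`, `C′ = c35·(L·L^{a′})·α₀`), EVERY matrix field `v` vanishing on
`range (embIter (K−n))` satisfies `√(Σ_x hs(v x)) ≤ √(2(κ₁ℓ_k⁴ + (κ₁ℓ_k⁴(2da + 8dτ₁²))²))·√(Σ_x hs(Δ_Wv x))` — LITERALLY the hypothesis `hP` of ym-routeR-w6 g6's
`…CovAgmonDecay.weighted_covLaplace_le_core` (`∀ v, (∀ y ∈ C, v y = 0) → √Σhs v ≤ A·√Σhs(Δ_Uv)`) at the member, with `A = √(2(κ₁ℓ_k⁴ + (κ₁ℓ_k⁴(2da + 8dτ₁²))²)) ≍ ℓ_k²`.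
HONEST SCOPE.  Square root of ✓ `sum_hs_le_covLaplace_hs_of_regPr`; nothing else.

References: T. Bałaban, CMP 102 (1985) 277–309 [Balaban1985Variational] (Prop. 7 p.299); CMP 99 (1985) 389–434 [Balaban1985BackgroundPropagators] ((3.35) p.396); M. Giaquinta,
*Multiple integrals in the calculus of variations and nonlinear elliptic systems* (1983), Ch. III §1 [Giaquinta1984].
-/

set_option autoImplicit false

noncomputable section

open scoped Matrix.Norms.L2Operator

namespace Summit.QuantumFields.YangMills.Theorems.Prop7CentrePinnedHessianPoincareCovFramesRoot

open Literature.MathematicalPhysics.QuantumFieldTheory.Balaban1983to89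
open Literature.MathematicalPhysics.QuantumFieldTheory.Balaban1983to89.T3ContinuumYM3Torus
open Literature.MathematicalPhysics.QuantumFieldTheory.Balaban1983to89.T3PrintedRegularMinimiser (RegPr)
open Literature.MathematicalPhysics.QuantumFieldTheory.Balaban1983to89.B6GlobalChartV1 (PV)
open B9Eq39Adjoint (covD divB plaqU)
open B9TorusCalculus (torusT)
open B10Eq27TorusAxialLog (unitsField toUField)
open B15DeterminingSets (embIter)
open Summit.QuantumFields.YangMills.Theorems.Prop7SectET3Members (hd3)
open Summit.QuantumFields.YangMills.Theorems.Prop7CentrePinnedHessianPoincareCovFrames (sum_hs_le_covLaplace_hs_of_regPr)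

variable {ℓ : ℕ} {hL : Odd (ℓ + 1) ∧ 1 < ℓ + 1}

/-- ★★ **(D1-cov) AT THE MEMBER, ROOT FORM** = the `hP` row of ym-routeR-w6 g6's `…CovAgmonDecay.weighted_covLaplace_le_core` at `C := range (embIter (K−n))`, `i := 0`, `N := 2`:
`√(Σ_x hs(v x)) ≤ √(2(κ₁ℓ_k⁴ + (κ₁ℓ_k⁴(2da + 8dτ₁²))²))·√(Σ_x hs(Δ_Wv x))` for every `v` vanishing on the centres (see the module docstring).
[cite: Balaban1985Variational, Prop. 7 p.299; Balaban1985BackgroundPropagators, (3.35) p.396; Giaquinta1984, Ch. III §1 Thm 1.2 pp.70–72] -/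
theorem sqrt_sum_hs_le_of_regPr (hℓ4 : 4 ≤ ℓ) :
    ∃ c35 a₅ : ℝ, 0 < c35 ∧ 0 < a₅ ∧
      ∀ (hℓ : 4 ≤ ℓ) (m : ℕ) (hm : 1 ≤ m) (n K a' R : ℕ) (hk1 : 1 ≤ K - n) (hsize : a' + 3 ≤ m + n) (hM8 : 8 ≤ (ℓ + 1) ^ a')
        (hR2 : 2 * (ℓ + 1) ^ 2 ≤ R) (α₀ : ℝ), 0 < α₀ → ((ℓ + 1 : ℕ) : ℝ) * (((ℓ + 1) ^ a' : ℕ) : ℝ) * α₀ ≤ a₅ →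
        ∀ W : GaugeField (PV 2 ℓ m K hd3 hL) 0 (Matrix.specialUnitaryGroup (Fin 2) ℂ),
          RegPr (⟨ℓ + 1, hL, m, hm⟩ : T3Family) n K α₀ W →
          ∀ {a : ℝ}, (∀ (μ ν : Fin (PV 2 ℓ m K hd3 hL).d) (x : Site (PV 2 ℓ m K hd3 hL) 0),
              ‖(plaqU (torusT (PV 2 ℓ m K hd3 hL) 0) (fun κ z => unitsField (toUField W) ⟨z, κ⟩) μ ν x : Matrix (Fin 2) (Fin 2) ℂ) - 1‖ ≤ a) →
          (4 * 2197 * (24 * 289 * 24576 * 46116) : ℝ) * ((2 : ℕ) : ℝ) ^ 2 * ((((PV 2 ℓ m K hd3 hL).L : ℝ)) ^ (K - n)) ^ 4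
              * ((((PV 2 ℓ m K hd3 hL).d : ℝ)) ^ 2 * (4 * ((2 : ℕ) : ℝ) * a ^ 2
                + (2 * ((((ℓ + 1 : ℕ) : ℝ) ^ (K - n))⁻¹ * ((((ℓ + 1 : ℕ) : ℝ) ^ (K - n))⁻¹ * (c35 * (((ℓ + 1 : ℕ) : ℝ) * (((ℓ + 1) ^ a' : ℕ) : ℝ)) * α₀))
                    * Real.exp ((((ℓ + 1 : ℕ) : ℝ) ^ (K - n))⁻¹ * (c35 * (((ℓ + 1 : ℕ) : ℝ) * (((ℓ + 1) ^ a' : ℕ) : ℝ)) * α₀)))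
                  + 4 * ((((ℓ + 1 : ℕ) : ℝ) ^ (K - n))⁻¹ * (c35 * (((ℓ + 1 : ℕ) : ℝ) * (((ℓ + 1) ^ a' : ℕ) : ℝ)) * α₀)
                    * Real.exp ((((ℓ + 1 : ℕ) : ℝ) ^ (K - n))⁻¹ * (c35 * (((ℓ + 1 : ℕ) : ℝ) * (((ℓ + 1) ^ a' : ℕ) : ℝ)) * α₀))) ^ 2) ^ 2)) ≤ 1 / 4 →
          ∀ v : Site (PV 2 ℓ m K hd3 hL) 0 → Matrix (Fin 2) (Fin 2) ℂ, (∀ y ∈ Set.range (embIter (P := PV 2 ℓ m K hd3 hL) (K - n)), v y = 0) →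
            Real.sqrt (∑ x : Site (PV 2 ℓ m K hd3 hL) 0, ∑ j : Fin 2, ∑ k' : Fin 2, ‖(v x) j k'‖ ^ 2)
              ≤ Real.sqrt (2 * ((4 * 2197 * (24 * 289 * 24576 * 46116) : ℝ) * ((2 : ℕ) : ℝ) ^ 2 * ((((PV 2 ℓ m K hd3 hL).L : ℝ)) ^ (K - n)) ^ 4
                    + ((4 * 2197 * (24 * 289 * 24576 * 46116) : ℝ) * ((2 : ℕ) : ℝ) ^ 2 * ((((PV 2 ℓ m K hd3 hL).L : ℝ)) ^ (K - n)) ^ 4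
                      * (2 * (PV 2 ℓ m K hd3 hL).d * a + 8 * (PV 2 ℓ m K hd3 hL).d
                        * ((((ℓ + 1 : ℕ) : ℝ) ^ (K - n))⁻¹ * (c35 * (((ℓ + 1 : ℕ) : ℝ) * (((ℓ + 1) ^ a' : ℕ) : ℝ)) * α₀)
                          * Real.exp ((((ℓ + 1 : ℕ) : ℝ) ^ (K - n))⁻¹ * (c35 * (((ℓ + 1 : ℕ) : ℝ) * (((ℓ + 1) ^ a' : ℕ) : ℝ)) * α₀))) ^ 2)) ^ 2))
                * Real.sqrt (∑ x : Site (PV 2 ℓ m K hd3 hL) 0, ∑ j : Fin 2, ∑ k' : Fin 2,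
                    ‖(divB (torusT (PV 2 ℓ m K hd3 hL) 0) (fun κ z => unitsField (toUField W) ⟨z, κ⟩)
                        (fun κ => covD (torusT (PV 2 ℓ m K hd3 hL) 0) (fun κ z => unitsField (toUField W) ⟨z, κ⟩) κ v) x) j k'‖ ^ 2) := by
  obtain ⟨c35, a₅, hc35, ha₅, H⟩ := sum_hs_le_covLaplace_hs_of_regPr (hL := hL) hℓ4
  refine ⟨c35, a₅, hc35, ha₅, ?_⟩
  intro hℓ m hm n K a' R hk1 hsize hM8 hR2 α₀ hα₀ hMα W hreg a hplaq hwin v hv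
  have hv0 : ∀ y : Site (PV 2 ℓ m K hd3 hL) (K - n), v (embIter (K - n) y) = 0 := fun y => hv _ ⟨y, rfl⟩
  have h := H hℓ m hm n K a' R hk1 hsize hM8 hR2 α₀ hα₀ hMα W hreg hplaq v hv0 hwin
  rw [← Real.sqrt_mul (by positivity)]
  exact Real.sqrt_le_sqrt h

end Summit.QuantumFields.YangMills.Theorems.Prop7CentrePinnedHessianPoincareCovFramesRoot

end
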